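import Summits.Langlands.Langlands.Theses.ParityBlindBianchi

/-!
BC3 birth skeleton — child `WeakAutomorphy` of `ParityBlindBianchi.EvenArtinJunction` (stmt-Langlands-2908),
crux-strategist planner-cstrat-stmt-Langlands-2908-r1-0, 2026-08-17.  Exactly 2 named stubs (the ONLY sorries) and
`WeakAutomorphy_of : stub₁ → stub₂ → WeakAutomorphy` kernel-checked.  Context = the route file's (the child is restated from Sketch.lean;
after `route edit --split` installs the child decl, delete the `def` below and re-run `ledger skeleton check`).
Stubs (verbatim the 10368 birth): B₁ totally real / CM base fields; B₂ the other number fields.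
-/

set_option linter.dupNamespace false

namespace Summit.Langlands.Langlands.Theses.ParityBlindBianchi

open scoped BigOperators Topology Manifold Classical MeasureTheory ProbabilityTheory Matrix InnerProductSpace ComplexConjugate ContinuousMap
open Filter Set Function TopologicalSpace MeasureTheory

/-- B_w — weak automorphy (Fontaine–Mazur–Langlands, a.e. form). -/
def WeakAutomorphy : Prop :=
  ∀ (K : Type) [Field K] [NumberField K] (n : ℕ) (hcpt : Literature.NumberTheory.Automorphic.isCompact_glFiniteIntegralLevel n K), 0 < n → ∀ (ℓ : ℕ) [Fact ℓ.Prime] (ι : PadicAlgCl ℓ ≃+* ℂ) (ρ : Literature.NumberTheory.GaloisRepresentations.FramedGaloisRep K (PadicAlgCl ℓ) n), ρ.toGaloisRep.IsIrreducible → ((∀ᶠ v : IsDedekindDomain.HeightOneSpectrum (NumberField.RingOfIntegers K) in cofinite, ρ.IsUnramifiedAt v) ∧ ∀ (v : IsDedekindDomain.HeightOneSpectrum (NumberField.RingOfIntegers K)) (hv : ((ℓ : ℕ) : NumberField.RingOfIntegers K) ∈ v.asIdeal), (Literature.NumberTheory.PAdicHodge.fontainePstAdicCompletion v ℓ hv).IsDeRhamFramed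 (ρ.toLocal v)) → ∃ π : Literature.NumberTheory.Automorphic.CuspidalAutomorphicRepData n K hcpt, π.1.IsLAlgebraic ∧ ∀ᶠ v : IsDedekindDomain.HeightOneSpectrum (NumberField.RingOfIntegers K) in cofinite, SatakeFrobCompatibleAt ι π.1 ρ v

namespace Cruxes.WeakAutomorphy.Birth

/-- **stub B₁ (OPEN off the known regimes: weak automorphy over TOTALLY REAL or CM fields)** — the world of every
automorphy-lifting theorem (Taylor–Wiles–Kisin, BLGGT potential automorphy, Calegari–Geraghty / ACC+ 2023 over CM
fields, Pan 2022 over `ℚ`): irreducible pinned-geometric `ρ : Γ_K → GL_n(ℚ̄_ℓ)`, `K` totally real or CM, is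
Satake–Frobenius compatible a.e. with an L-algebraic cuspidal `π`.  Open in general (residual automorphy, even /
irregular `ρ`, non-polarizable `n ≥ 3` beyond ACC+).  VERBATIM the stub B₁ of the 10368 birth of `WeakAutomorphy`.
[cite: FontaineMazurGeometric1995, Conj. 1] [cite: ACCGHLNSTT2023, Thm. 1.0.1] -/
theorem stub_weakAutomorphy_shimuraFields :
    ∀ (K : Type) [Field K] [NumberField K], (NumberField.IsTotallyReal K ∨ NumberField.IsCMField K) → ∀ (n : ℕ) (hcpt : Literature.NumberTheory.Automorphic.isCompact_glFiniteIntegralLevel n K), 0 < n → ∀ (ℓ : ℕ) [Fact ℓ.Prime] (ι : PadicAlgCl ℓ ≃+* ℂ) (ρ : Literature.NumberTheory.GaloisRepresentations.FramedGaloisRep K (PadicAlgCl ℓ) n), ρ.toGaloisRep.IsIrreducible → ((∀ᶠ v : IsDedekindDomain.HeightOneSpectrum (NumberField.RingOfIntegers K) in cofinite, ρ.IsUnramifiedAt v) ∧ ∀ (v : IsDedekindDomain.HeightOneSpectrum (NumberField.RingOfIntegers K)) (hv : ((ℓ : ℕ) : NumberField.RingOfIntegers K) ∈ v.asIdeal),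 (Literature.NumberTheory.PAdicHodge.fontainePstAdicCompletion v ℓ hv).IsDeRhamFramed (ρ.toLocal v)) → ∃ π : Literature.NumberTheory.Automorphic.CuspidalAutomorphicRepData n K hcpt, π.1.IsLAlgebraic ∧ ∀ᶠ v : IsDedekindDomain.HeightOneSpectrum (NumberField.RingOfIntegers K) in cofinite, SatakeFrobCompatibleAt ι π.1 ρ v := by
  sorry

/-- **stub B₂ (OPEN, no method at all: weak automorphy over number fields that are NEITHER totally real NOR CM)** —
the far side of `ShimuraVarietyRealizationBarrier` / `ShtukaConstantFieldBarrier`: no Shimura variety realises the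
relevant automorphic forms, no Taylor–Wiles patching is set up, and potential automorphy only moves the problem to a
CM extension without (insoluble) descent.  VERBATIM the stub B₂ of the 10368 birth. [cite: FontaineMazurGeometric1995, Conj. 1]
[cite: BuzzardGeeLMS2014, Conj. 3.2.2] -/
theorem stub_weakAutomorphy_generalFields :
    ∀ (K : Type) [Field K] [NumberField K], ¬ (NumberField.IsTotallyReal K ∨ NumberField.IsCMField K) → ∀ (n : ℕ) (hcpt : Literature.NumberTheory.Automorphic.isCompact_glFiniteIntegralLevel n K), 0 < n → ∀ (ℓ : ℕ) [Fact ℓ.Prime] (ι : PadicAlgCl ℓ ≃+* ℂ) (ρ : Literature.NumberTheory.GaloisRepresentations.FramedGaloisRep K (PadicAlgCl ℓ) n), ρ.toGaloisRep.IsIrreducible → ((∀ᶠ v : IsDedekindDomain.HeightOneSpectrum (NumberField.RingOfIntegers K) in cofinite, ρ.IsUnramifiedAt v) ∧ ∀ (v : IsDedekindDomain.HeightOneSpectrum (NumberField.RingOfIntegers K)) (hv : ((ℓ : ℕ) : NumberField.RingOfIntegers K) ∈ v.asIdeal), (Literature.NumberTheory.PAdicHodge.fontainePstAdicCompletion v ℓ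 hv).IsDeRhamFramed (ρ.toLocal v)) → ∃ π : Literature.NumberTheory.Automorphic.CuspidalAutomorphicRepData n K hcpt, π.1.IsLAlgebraic ∧ ∀ᶠ v : IsDedekindDomain.HeightOneSpectrum (NumberField.RingOfIntegers K) in cofinite, SatakeFrobCompatibleAt ι π.1 ρ v := by
  sorry

/-- **B_w from its two stubs** (case split on the base field). -/
theorem WeakAutomorphy_of :
    (∀ (K : Type) [Field K] [NumberField K], (NumberField.IsTotallyReal K ∨ NumberField.IsCMField K) → ∀ (n : ℕ) (hcpt : Literature.NumberTheory.Automorphic.isCompact_glFiniteIntegralLevel n K), 0 < n → ∀ (ℓ : ℕ) [Fact ℓ.Prime] (ι : PadicAlgCl ℓ ≃+* ℂ) (ρ : Literature.NumberTheory.GaloisRepresentations.FramedGaloisRep K (PadicAlgCl ℓ) n), ρ.toGaloisRep.IsIrreducible → ((∀ᶠ v : IsDedekindDomain.HeightOneSpectrum (NumberField.RingOfIntegers K) in cofinite, ρ.IsUnramifiedAt v) ∧ ∀ (v : IsDedekindDomain.HeightOneSpectrum (NumberField.RingOfIntegers K)) (hv : ((ℓ : ℕ) : NumberField.RingOfIntegers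 K) ∈ v.asIdeal), (Literature.NumberTheory.PAdicHodge.fontainePstAdicCompletion v ℓ hv).IsDeRhamFramed (ρ.toLocal v)) → ∃ π : Literature.NumberTheory.Automorphic.CuspidalAutomorphicRepData n K hcpt, π.1.IsLAlgebraic ∧ ∀ᶠ v : IsDedekindDomain.HeightOneSpectrum (NumberField.RingOfIntegers K) in cofinite, SatakeFrobCompatibleAt ι π.1 ρ v) →
    (∀ (K : Type) [Field K] [NumberField K], ¬ (NumberField.IsTotallyReal K ∨ NumberField.IsCMField K) → ∀ (n : ℕ) (hcpt : Literature.NumberTheory.Automorphic.isCompact_glFiniteIntegralLevel n K), 0 < n → ∀ (ℓ : ℕ) [Fact ℓ.Prime] (ι : PadicAlgCl ℓ ≃+* ℂ) (ρ : Literature.NumberTheory.GaloisRepresentations.FramedGaloisRep K (PadicAlgCl ℓ) n), ρ.toGaloisRep.IsIrreducible → ((∀ᶠ v : IsDedekindDomain.HeightOneSpectrum (NumberField.RingOfIntegers K) in cofinite, ρ.IsUnramifiedAt v) ∧ ∀ (v : IsDedekindDomain.HeightOneSpectrum (NumberField.RingOfIntegers K)) (hv : ((ℓ : ℕ) : NumberField.RingOfIntegers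 K) ∈ v.asIdeal), (Literature.NumberTheory.PAdicHodge.fontainePstAdicCompletion v ℓ hv).IsDeRhamFramed (ρ.toLocal v)) → ∃ π : Literature.NumberTheory.Automorphic.CuspidalAutomorphicRepData n K hcpt, π.1.IsLAlgebraic ∧ ∀ᶠ v : IsDedekindDomain.HeightOneSpectrum (NumberField.RingOfIntegers K) in cofinite, SatakeFrobCompatibleAt ι π.1 ρ v) →
    WeakAutomorphy := by
  intro h1 h2 K _ _ n hcpt hn ℓ _ ι ρ hirr hgeo
  by_cases hK : NumberField.IsTotallyReal K ∨ NumberField.IsCMField K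
  · exact h1 K hK n hcpt hn ℓ ι ρ hirr hgeo
  · exact h2 K hK n hcpt hn ℓ ι ρ hirr hgeo

/-- The composition with the stubs plugged in: `WeakAutomorphy` modulo exactly {B₁, B₂}. -/
theorem WeakAutomorphy_of_stubs : WeakAutomorphy :=
  WeakAutomorphy_of stub_weakAutomorphy_shimuraFields stub_weakAutomorphy_generalFields

end Cruxes.WeakAutomorphy.Birth

end Summit.Langlands.Langlands.Theses.ParityBlindBianchi
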